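import Mathlib.LinearAlgebra.Matrix.NonsingularInverse
import Literature.Computability.AlgebraicComplexity.UpperSupportFunctionalMatMul
import Literature.Computability.AlgebraicComplexity.QuantumFunctionalsDegenerationProofs
import HarnessLib

/-!
# Lower bounds for Strassen's upper support functional along restrictions to oblique tensors

Topic: `Literature/Computability/AlgebraicComplexity` (support file for Strassen's support functionals,
`QuantumFunctionals.lean`). The main theorem
`weightedEntropy_le_logUpperSupportFunctional_of_restrictsTo` says: if `v ≥ u` (restriction,
`TensorRestrictsTo v u`, any formats) and the support of `u` in the standard bases is an antichain for
the product of three total orders (given by injective weights `w₁, w₂, w₃`; `u` is then *oblique*,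
CVZ Def. 2.18), then for every `θ ≥ 0` and every probability distribution `P` supported in `supp u`,
`H_θ(P) ≤ ρ^θ(v)`. This is Strassen's chain `ζ^θ(v) ≥ ζ^θ(u) ≥ ζ_θ(u) = 2^{H_θ(supp u)}`
([Str91, §4]; [CVZ23, Thm. 2.4(4) with Thm. 2.15 and Thm. 2.19]) in the one form the barrier files use
(`v = T^{⊗k} ≥ ⟨s⟩ ⊗ ⟨n,n,m⟩`), proved directly, i.e. WITHOUT the general restriction-monotonicity of
`ζ^θ` (which needs flags adapted to arbitrary linear maps): CVZ Prop. 2.16 is generalised from base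
changes to arbitrary (rectangular, possibly singular) matrices. The case `u = v` is
`weightedEntropy_le_logUpperSupportFunctional_of_antichain` (`UpperSupportFunctionalMatMul.lean`).

## Proof

* `exists_ranks_upperClosure` — **Strassen's ordering lemma** ([CVZ23, Prop. 2.6]): for every
  `Φ ⊆ ι × κ × μ` there are injective ranks `rᵢ` on the three index sets such that every distribution
  supported in the *upper closure* of `Φ` for the ranks has `H_θ ≤ H_θ(Φ)` (sort each factor by
  increasing marginal of a maximiser `P*`, `exists_rank_monotone`; the first-order conditions
  `IsMaxOn.marginal_pos_and_score_le` and Gibbs' inequality `weightedEntropy_le_sum_mul_score` of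
  `WeightedEntropyMax.lean` do the rest).
* `exists_leading_injOn` — CVZ Prop. 2.16 for one factor and an ARBITRARY matrix `A : ι' × ι` (the
  rows need not form a basis): there is `φ : ι' → ι` such that for every `β` some combination
  `∑ λ_{β'} row_{β'} A` with leading coefficient vector `λ` at `β` (for the weight `w` on `ι'`) lies
  in the flag space `{p | p a = 0 whenever r (φ β) < r a}` of the standard basis of `K^ι`, and `φ` is
  injective on every set `B` of indices `β` for which no such combination vanishes.
* `exists_support_le_of_actTensor` — three factors: for `u = (A ⊗ B ⊗ C)·v` with antichain support,
  no leading combination at a coordinate of a support point vanishes (evaluate the trilinear form,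
  `sum_trilinear_leading` of `SupportFlags.lean`), so the `φᵢ` are injective on the projections of
  `supp u`, and every `x ∈ supp u` gives a point `y ∈ supp v` with `rᵢ yᵢ ≤ rᵢ (φᵢ xᵢ)`.
* `weightedEntropy_pushforward_eq` — pushing `P` forward along `φ₁ × φ₂ × φ₃` (injective on the
  projections of its support) preserves `H_θ`; the image is supported in the upper closure of
  `supp (g·v)` for every base change `g` (`u` is a restriction of `g·v` too, `actTensor_actTensor`),
  whence the main theorem by the ordering lemma and `le_ciInf`.

No definitions are introduced. References: V. Strassen, J. reine angew. Math. 413 (1991) 127–180, §4;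
M. Christandl, P. Vrana, J. Zuiddam, J. Amer. Math. Soc. 36 (2023), Prop. 2.6, Prop. 2.16, Thm. 2.19.
-/

noncomputable section

open scoped BigOperators

namespace Literature.Computability.AlgebraicComplexity

/-! ## The ordering lemma: ranks for which the upper closure has the same maximal entropy -/

section Ordering

variable {ι κ μ : Type*} [Fintype ι] [Fintype κ] [Fintype μ]
variable [DecidableEq ι] [DecidableEq κ] [DecidableEq μ]

/-- **Strassen's ordering lemma** ([CVZ23, Prop. 2.6]: `ρ^θ` may be computed with flags). For
`θ ≥ 0` and `Φ ⊆ ι × κ × μ` there are injective ranks `r₁, r₂, r₃` on the three index sets such that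
every probability distribution `Q` supported in the upper closure
`{z | ∃ y ∈ Φ, rᵢ yᵢ ≤ rᵢ zᵢ (i = 1,2,3)}` satisfies `H_θ(Q) ≤ H_θ(Φ)`: sort each index set by increasing
marginal of a maximiser `P*` of `H_θ` on `P(Φ)`; by the first-order conditions the score
`∑ θᵢ log₂(1/P*ᵢ(yᵢ))` is `≤ H_θ(P*)` on `Φ` and decreases along the ranks, and Gibbs' inequality bounds
`H_θ(Q)` by the `Q`-average of the score. [cite: ChristandlVranaZuiddam2023, Prop. 2.6] -/
theorem exists_ranks_upperClosure {θ : Fin 3 → ℝ} (hθ : ∀ i, 0 ≤ θ i) (Φ : Set (ι × κ × μ)) :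
    ∃ (r₁ : ι → ℕ) (r₂ : κ → ℕ) (r₃ : μ → ℕ), Function.Injective r₁ ∧ Function.Injective r₂ ∧
      Function.Injective r₃ ∧ ∀ Q : ι × κ × μ → ℝ, Q ∈ stdSimplex ℝ (ι × κ × μ) →
        (∀ z, Q z ≠ 0 → ∃ y ∈ Φ, r₁ y.1 ≤ r₁ z.1 ∧ r₂ y.2.1 ≤ r₂ z.2.1 ∧ r₃ y.2.2 ≤ r₃ z.2.2) →
        weightedEntropy θ Q ≤ maxWeightedEntropy θ Φ := by
  classical
  rcases Φ.eq_empty_or_nonempty with hΦ | hΦ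
  · obtain ⟨r₁, hr₁, -⟩ := exists_rank_monotone (fun _ : ι => (0 : ℝ))
    obtain ⟨r₂, hr₂, -⟩ := exists_rank_monotone (fun _ : κ => (0 : ℝ))
    obtain ⟨r₃, hr₃, -⟩ := exists_rank_monotone (fun _ : μ => (0 : ℝ))
    refine ⟨r₁, r₂, r₃, hr₁, hr₂, hr₃, fun Q hQ hcl => ?_⟩
    exfalso
    have h0 : ∀ z, Q z = 0 := fun z => by
      by_contra h
      obtain ⟨y, hy, -⟩ := hcl z h
      rw [hΦ] at hy
      exact hy
    have h1 := hQ.2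
    simp [h0] at h1
  obtain ⟨P, ⟨hP, hs⟩, hmax⟩ := exists_isMaxOn_weightedEntropy θ hΦ
  obtain ⟨r₁, hr₁, hm₁⟩ := exists_rank_monotone (marginalDist₁ P)
  obtain ⟨r₂, hr₂, hm₂⟩ := exists_rank_monotone (marginalDist₂ P)
  obtain ⟨r₃, hr₃, hm₃⟩ := exists_rank_monotone (marginalDist₃ P)
  refine ⟨r₁, r₂, r₃, hr₁, hr₂, hr₃, fun Q hQ hcl => ?_⟩
  rw [maxWeightedEntropy_eq_of_isMaxOn ⟨hP, hs⟩ hmax]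
  have hp₁ := marginalDist₁_mem_stdSimplex hP
  have hp₂ := marginalDist₂_mem_stdSimplex hP
  have hp₃ := marginalDist₃_mem_stdSimplex hP
  have hlog2 : 0 < Real.log 2 := Real.log_pos one_lt_two
  -- KKT at the points of `Φ`
  have kkt : ∀ y ∈ Φ, ((0 < θ 0 → 0 < marginalDist₁ P y.1) ∧ (0 < θ 1 → 0 < marginalDist₂ P y.2.1) ∧
      (0 < θ 2 → 0 < marginalDist₃ P y.2.2)) ∧
      θ 0 * (-Real.log (marginalDist₁ P y.1) / Real.log 2) +
        θ 1 * (-Real.log (marginalDist₂ P y.2.1) / Real.log 2) +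
        θ 2 * (-Real.log (marginalDist₃ P y.2.2) / Real.log 2) ≤ weightedEntropy θ P :=
    fun y hy => IsMaxOn.marginal_pos_and_score_le hθ hP hs hmax hy
  -- one coordinate of the score is antitone along the ranks above a point of `Φ`
  have mono : ∀ (t p q : ℝ), 0 ≤ t → (0 < t → 0 < p) → p ≤ q →
      t * (-Real.log q / Real.log 2) ≤ t * (-Real.log p / Real.log 2) := by
    intro t p q ht htp hpq
    rcases ht.eq_or_lt with h | h
    · rw [← h, zero_mul, zero_mul]
    · refine mul_le_mul_of_nonneg_left (div_le_div_of_nonneg_right ?_ hlog2.le) ht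
      exact neg_le_neg (Real.log_le_log (htp h) hpq)
  have key := weightedEntropy_le_sum_mul_score hθ hQ hp₁.1 hp₁.2.le hp₂.1 hp₂.2.le hp₃.1 hp₃.2.le
    (fun z hz => by
      obtain ⟨y, hy, h1, h2, h3⟩ := hcl z hz
      obtain ⟨⟨k1, k2, k3⟩, -⟩ := kkt y hy
      exact ⟨fun h => (k1 h).trans_le (hm₁ _ _ h1), fun h => (k2 h).trans_le (hm₂ _ _ h2),
        fun h => (k3 h).trans_le (hm₃ _ _ h3)⟩)
  refine key.trans ?_
  calc ∑ z, Q z * (θ 0 * (-Real.log (marginalDist₁ P z.1) / Real.log 2) +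
          θ 1 * (-Real.log (marginalDist₂ P z.2.1) / Real.log 2) +
          θ 2 * (-Real.log (marginalDist₃ P z.2.2) / Real.log 2))
      ≤ ∑ z, Q z * weightedEntropy θ P := by
        refine Finset.sum_le_sum fun z _ => ?_
        rcases eq_or_ne (Q z) 0 with hz | hz
        · rw [hz, zero_mul, zero_mul]
        · refine mul_le_mul_of_nonneg_left ?_ (hQ.1 z)
          obtain ⟨y, hy, h1, h2, h3⟩ := hcl z hz
          obtain ⟨⟨k1, k2, k3⟩, hsc⟩ := kkt y hy
          refine le_trans ?_ hsc
          exact add_le_add (add_le_add (mono _ _ _ (hθ 0) k1 (hm₁ _ _ h1))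
            (mono _ _ _ (hθ 1) k2 (hm₂ _ _ h2))) (mono _ _ _ (hθ 2) k3 (hm₃ _ _ h3))
    _ = weightedEntropy θ P := by rw [← Finset.sum_mul, hQ.2, one_mul]

end Ordering

/-! ## CVZ Prop. 2.16 for restrictions: one factor -/

section OneFactor

variable {K : Type*} [Field K] {ι ι' : Type*} [Fintype ι] [Fintype ι'] [DecidableEq ι] [DecidableEq ι']
variable {R W : Type*} [LinearOrder R] [LinearOrder W]

omit [Fintype ι] [DecidableEq ι] [Fintype ι'] [DecidableEq ι'] in
/-- Descent in the standard flag: a nonzero vector supported on ranks `≤ r α` and vanishing at `α`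
is supported on ranks `≤ r α₀` for some `r α₀ < r α`. [folklore] -/
theorem exists_rank_lt_of_apply_eq_zero [Fintype ι] (r : ι → R) (hr : Function.Injective r) (α : ι)
    (p : ι → K) (hp : ∀ a, r α < r a → p a = 0) (hpα : p α = 0) (hp0 : p ≠ 0) :
    ∃ α₀, r α₀ < r α ∧ ∀ a, r α₀ < r a → p a = 0 := by
  classical
  have hex : ∃ a, p a ≠ 0 := by
    by_contra h
    push Not at h
    exact hp0 (funext h)
  obtain ⟨a₁, ha₁⟩ := hex
  obtain ⟨α₀, hα₀, hmax⟩ :=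
    Finset.exists_max_image (Finset.univ.filter fun a => p a ≠ 0) r ⟨a₁, by simp [ha₁]⟩
  have hα₀' : p α₀ ≠ 0 := (Finset.mem_filter.1 hα₀).2
  refine ⟨α₀, ?_, fun a ha => ?_⟩
  · have hle : r α₀ ≤ r α := not_lt.1 fun h => hα₀' (hp α₀ h)
    refine lt_of_le_of_ne hle fun h => ?_
    rw [hr h] at hα₀'
    exact hα₀' hpα
  · by_contra hne
    exact absurd ha (not_lt.2 (hmax a (by simp [hne])))

omit [DecidableEq ι] in
/-- **CVZ Prop. 2.16, one factor, for an arbitrary matrix.** Let `A : ι' × ι` be any matrix (rows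
`A_β ∈ K^ι`), `r` an injective rank on `ι` (the standard basis of `K^ι` with its increasing flags
`V_{≤α} = {p | p a = 0 for r α < r a}`), `w` an injective weight on `ι'`. There is `φ : ι' → ι` such
that for every `β` some combination `∑ λ_{β'} A_{β'}` with `λ_β = 1`, `λ_{β'} = 0` for `w β' < w β`,
lies in `V_{≤ φ β}` (`φ β` is taken `r`-minimal), and `φ` is injective on any set `B` of indices for
which no such leading combination vanishes (if `φ β = φ γ = α`, `w β < w γ`, eliminating the
`α`-coordinate between the two witnesses gives a nonzero witness in a smaller flag space). For
invertible `A` and `B = ι'` this is `exists_injective_leading` (`SupportFlags.lean`).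
[cite: ChristandlVranaZuiddam2023, Prop. 2.16] -/
theorem exists_leading_injOn [Nonempty ι] (A : Matrix ι' ι K) (r : ι → R)
    (hr : Function.Injective r) (w : ι' → W) (hw : Function.Injective w) (B : Set ι')
    (hB : ∀ β ∈ B, ∀ l : ι' → K, l β = 1 → (∀ β', w β' < w β → l β' = 0) →
      (fun a => ∑ β', l β' * A β' a) ≠ 0) :
    ∃ φ : ι' → ι, Set.InjOn φ B ∧ ∀ β, ∃ l : ι' → K, l β = 1 ∧ (∀ β', w β' < w β → l β' = 0) ∧
      ∀ a, r (φ β) < r a → ∑ β', l β' * A β' a = 0 := by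
  classical
  let T : ι' → ι → Prop := fun β α => ∃ l : ι' → K, l β = 1 ∧ (∀ β', w β' < w β → l β' = 0) ∧
      ∀ a, r α < r a → ∑ β', l β' * A β' a = 0
  -- `T β` holds at the `r`-maximal index, with `l = δ_β`
  have hT : ∀ β, ∃ α, T β α := by
    intro β
    obtain ⟨αm, -, hαm⟩ := Finset.exists_max_image Finset.univ r (Finset.univ_nonempty (α := ι))
    refine ⟨αm, Pi.single β 1, by simp, fun β' h => by simp [ne_of_apply_ne w h.ne], fun a h => ?_⟩
    exact absurd (hαm a (Finset.mem_univ _)) (not_le.2 h)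
  -- `φ β` := an `r`-minimal element of `T β`
  have hmin : ∀ β, ∃ α, T β α ∧ ∀ α', T β α' → r α ≤ r α' := by
    intro β
    obtain ⟨α₁, hα₁⟩ := hT β
    obtain ⟨α, hα, h⟩ := Finset.exists_min_image (Finset.univ.filter (T β)) r ⟨α₁, by simp [hα₁]⟩
    exact ⟨α, (Finset.mem_filter.1 hα).2, fun α' h' => h α' (by simp [h'])⟩
  choose φ hφT hφmin using hmin
  refine ⟨φ, ?_, fun β => hφT β⟩
  -- injectivity on `B`, asymmetric form
  have key : ∀ β ∈ B, ∀ γ ∈ B, w β < w γ → φ β = φ γ → False := by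
    intro β hβ γ hγ hβγ heq
    obtain ⟨l, hl1, hlz, hlf⟩ := hφT β
    obtain ⟨m, hm1, hmz, hmf⟩ := hφT γ
    rw [← heq] at hmf
    set p : ι → K := fun a => ∑ β', l β' * A β' a with hp
    set q : ι → K := fun a => ∑ β', m β' * A β' a with hq
    by_cases hd : q (φ β) = 0
    · -- `q` lies in a smaller flag space: contradiction with the minimality of `φ γ`
      have hq0 : q ≠ 0 := hB γ hγ m hm1 hmz
      obtain ⟨α₀, hlt, hα₀⟩ := exists_rank_lt_of_apply_eq_zero r hr (φ β) q hmf hd hq0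
      have hle := hφmin γ α₀ ⟨m, hm1, hmz, hα₀⟩
      rw [← heq] at hle
      exact absurd hlt (not_lt.2 hle)
    · -- eliminate the `φ β`-coordinate: `l' = l - (p α / q α) m` has leading term `β`
      set k : K := p (φ β) / q (φ β) with hk
      set l' : ι' → K := fun β' => l β' - k * m β' with hl'
      have hl'1 : l' β = 1 := by simp [hl', hl1, hmz β hβγ]
      have hl'z : ∀ β', w β' < w β → l' β' = 0 := fun β' h => by
        simp [hl', hlz β' h, hmz β' (h.trans hβγ)]
      have hp'eq : (fun a => ∑ β', l' β' * A β' a) = fun a => p a - k * q a := by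
        funext a
        simp only [hl', hp, hq, sub_mul, Finset.sum_sub_distrib, Finset.mul_sum, mul_assoc]
      have hp'f : ∀ a, r (φ β) < r a → (fun a => p a - k * q a) a = 0 := fun a h => by
        have e1 : p a = 0 := hlf a h
        have e2 : q a = 0 := hmf a h
        show p a - k * q a = 0
        rw [e1, e2]
        ring
      have hp'α : (fun a => p a - k * q a) (φ β) = 0 := by
        show p (φ β) - k * q (φ β) = 0
        rw [hk, div_mul_cancel₀ _ hd, sub_self]
      have hp'0 : (fun a => p a - k * q a) ≠ 0 := by
        rw [← hp'eq]
        exact hB β hβ l' hl'1 hl'z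
      obtain ⟨α₀, hlt, hα₀⟩ := exists_rank_lt_of_apply_eq_zero r hr (φ β) _ hp'f hp'α hp'0
      have hle := hφmin β α₀ ⟨l', hl'1, hl'z, fun a ha => by
        have h1 : p a - k * q a = 0 := hα₀ a ha
        have h2 : ∑ β', l' β' * A β' a = p a - k * q a := congrFun hp'eq a
        rw [h2]
        exact h1⟩
      exact absurd hlt (not_lt.2 hle)
  intro β hβ γ hγ heq
  by_contra hne
  rcases lt_or_gt_of_ne (hw.ne hne) with h | h
  · exact key β hβ γ hγ h heq
  · exact key γ hγ β hβ h heq.symm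

end OneFactor

/-! ## Three factors: the trilinear form along a restriction -/

section ThreeFactors

variable {K : Type*} [Field K] {ι κ μ ι' κ' μ' : Type*}
variable [Fintype ι] [Fintype κ] [Fintype μ] [Fintype ι'] [Fintype κ'] [Fintype μ']

/-- Linearity of the trilinear form of `v` in the first argument (rows of a rectangular `A`).
[folklore] -/
theorem sum_trilinear_lin₁' (v : ι → κ → μ → K) (A : Matrix ι' ι K) (c₁ : ι' → K) (q : κ → K)
    (s : μ → K) :
    ∑ a, ∑ b, ∑ c, (∑ α, c₁ α * A α a) * q b * s c * v a b c =
      ∑ α, c₁ α * ∑ a, ∑ b, ∑ c, A α a * q b * s c * v a b c := by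
  rw [sum_trilinear_eq_sum₁]
  simp only [Finset.sum_mul]
  rw [Finset.sum_comm]
  refine Finset.sum_congr rfl fun α _ => ?_
  rw [sum_trilinear_eq_sum₁, Finset.mul_sum]
  exact Finset.sum_congr rfl fun a _ => by ring

/-- Linearity of the trilinear form of `v` in the second argument (rows of a rectangular `B`).
[folklore] -/
theorem sum_trilinear_lin₂' (v : ι → κ → μ → K) (B : Matrix κ' κ K) (p : ι → K) (c₂ : κ' → K)
    (s : μ → K) :
    ∑ a, ∑ b, ∑ c, p a * (∑ β, c₂ β * B β b) * s c * v a b c =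
      ∑ β, c₂ β * ∑ a, ∑ b, ∑ c, p a * B β b * s c * v a b c := by
  rw [sum_trilinear_eq_sum₂]
  simp only [Finset.sum_mul]
  rw [Finset.sum_comm]
  refine Finset.sum_congr rfl fun β _ => ?_
  rw [sum_trilinear_eq_sum₂, Finset.mul_sum]
  exact Finset.sum_congr rfl fun b _ => by ring

/-- Linearity of the trilinear form of `v` in the third argument (rows of a rectangular `C`).
[folklore] -/
theorem sum_trilinear_lin₃' (v : ι → κ → μ → K) (C : Matrix μ' μ K) (p : ι → K) (q : κ → K)
    (c₃ : μ' → K) :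
    ∑ a, ∑ b, ∑ c, p a * q b * (∑ γ, c₃ γ * C γ c) * v a b c =
      ∑ γ, c₃ γ * ∑ a, ∑ b, ∑ c, p a * q b * C γ c * v a b c := by
  rw [sum_trilinear_eq_sum₃]
  simp only [Finset.sum_mul]
  rw [Finset.sum_comm]
  refine Finset.sum_congr rfl fun γ _ => ?_
  rw [sum_trilinear_eq_sum₃, Finset.mul_sum]
  exact Finset.sum_congr rfl fun c _ => by ring

/-- The trilinear form of `v` on combinations of the rows of rectangular `A, B, C` is the trilinear
form of the restriction `(A ⊗ B ⊗ C)·v` on the coefficient vectors. [folklore] -/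
theorem sum_trilinear_rows' (v : ι → κ → μ → K) (A : Matrix ι' ι K) (B : Matrix κ' κ K)
    (C : Matrix μ' μ K) (c₁ : ι' → K) (c₂ : κ' → K) (c₃ : μ' → K) :
    ∑ a, ∑ b, ∑ c, (∑ α, c₁ α * A α a) * (∑ β, c₂ β * B β b) * (∑ γ, c₃ γ * C γ c) * v a b c =
      ∑ α, ∑ β, ∑ γ, c₁ α * c₂ β * c₃ γ * actTensor A B C v α β γ := by
  rw [sum_trilinear_lin₁']
  refine Finset.sum_congr rfl fun α _ => ?_
  rw [sum_trilinear_lin₂', Finset.mul_sum]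
  refine Finset.sum_congr rfl fun β _ => ?_
  rw [sum_trilinear_lin₃', Finset.mul_sum, Finset.mul_sum]
  refine Finset.sum_congr rfl fun γ _ => ?_
  rw [actTensor_apply]
  ring

variable [DecidableEq ι] [DecidableEq κ] [DecidableEq μ] [DecidableEq ι'] [DecidableEq κ'] [DecidableEq μ']

omit [DecidableEq ι] [DecidableEq κ] [DecidableEq μ] in
/-- **CVZ Prop. 2.16 along a restriction, three factors.** Let `u = (A ⊗ B ⊗ C)·v` (`A, B, C`
arbitrary rectangular matrices) have antichain support for the injective weights `w₁, w₂, w₃`, and let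
`r₁, r₂, r₃` be injective ranks on the index sets of `v`. There are maps `φ₁, φ₂, φ₃`, injective on
the three projections of `supp u`, such that every `x ∈ supp u` gives a point `y ∈ supp v` with
`rᵢ yᵢ ≤ rᵢ (φᵢ xᵢ)`, i.e. `(φ₁ × φ₂ × φ₃)(supp u)` lies in the upper closure of `supp v` for the ranks.
(No leading combination at a coordinate of a support point of `u` vanishes: pair it with the two
standard basis vectors at the other coordinates and evaluate the trilinear form,
`sum_trilinear_leading`.) [cite: ChristandlVranaZuiddam2023, Prop. 2.16] -/
theorem exists_support_le_of_actTensor {W₁ W₂ W₃ : Type*} [LinearOrder W₁] [LinearOrder W₂]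
    [LinearOrder W₃] {R₁ R₂ R₃ : Type*} [LinearOrder R₁] [LinearOrder R₂] [LinearOrder R₃]
    [Nonempty ι] [Nonempty κ] [Nonempty μ]
    (v : ι → κ → μ → K) (A : Matrix ι' ι K) (B : Matrix κ' κ K) (C : Matrix μ' μ K)
    (w₁ : ι' → W₁) (w₂ : κ' → W₂) (w₃ : μ' → W₃)
    (hw₁ : Function.Injective w₁) (hw₂ : Function.Injective w₂) (hw₃ : Function.Injective w₃)
    (hanti : ∀ x ∈ tensorSupport (actTensor A B C v), ∀ y ∈ tensorSupport (actTensor A B C v),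
      w₁ x.1 ≤ w₁ y.1 → w₂ x.2.1 ≤ w₂ y.2.1 → w₃ x.2.2 ≤ w₃ y.2.2 → y = x)
    (r₁ : ι → R₁) (r₂ : κ → R₂) (r₃ : μ → R₃) (hr₁ : Function.Injective r₁)
    (hr₂ : Function.Injective r₂) (hr₃ : Function.Injective r₃) :
    ∃ (φ₁ : ι' → ι) (φ₂ : κ' → κ) (φ₃ : μ' → μ),
      Set.InjOn φ₁ {a | ∃ x ∈ tensorSupport (actTensor A B C v), x.1 = a} ∧
      Set.InjOn φ₂ {b | ∃ x ∈ tensorSupport (actTensor A B C v), x.2.1 = b} ∧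
      Set.InjOn φ₃ {c | ∃ x ∈ tensorSupport (actTensor A B C v), x.2.2 = c} ∧
      ∀ x ∈ tensorSupport (actTensor A B C v), ∃ y ∈ tensorSupport v,
        r₁ y.1 ≤ r₁ (φ₁ x.1) ∧ r₂ y.2.1 ≤ r₂ (φ₂ x.2.1) ∧ r₃ y.2.2 ≤ r₃ (φ₃ x.2.2) := by
  -- the trilinear form of `v` on leading combinations evaluates to the value of `u`
  have heval : ∀ x ∈ tensorSupport (actTensor A B C v), ∀ (l : ι' → K) (m : κ' → K) (n : μ' → K),
      l x.1 = 1 → (∀ β', w₁ β' < w₁ x.1 → l β' = 0) →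
      m x.2.1 = 1 → (∀ β', w₂ β' < w₂ x.2.1 → m β' = 0) →
      n x.2.2 = 1 → (∀ β', w₃ β' < w₃ x.2.2 → n β' = 0) →
      ∑ a, ∑ b, ∑ c, (∑ α, l α * A α a) * (∑ β, m β * B β b) * (∑ γ, n γ * C γ c) * v a b c =
        actTensor A B C v x.1 x.2.1 x.2.2 := by
    intro x hx l m n hl1 hlz hm1 hmz hn1 hnz
    rw [sum_trilinear_rows', sum_trilinear_leading (actTensor A B C v) w₁ w₂ w₃ hanti hx hl1 hlz hm1 hmz
      hn1 hnz]
  -- no leading combination at a coordinate of a support point vanishes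
  have hB₁ : ∀ β ∈ {a | ∃ x ∈ tensorSupport (actTensor A B C v), x.1 = a}, ∀ l : ι' → K, l β = 1 →
      (∀ β', w₁ β' < w₁ β → l β' = 0) → (fun a => ∑ β', l β' * A β' a) ≠ 0 := by
    rintro β ⟨x, hx, rfl⟩ l hl1 hlz h0
    have h := heval x hx l (Pi.single x.2.1 1) (Pi.single x.2.2 1) hl1 hlz (by simp)
      (fun β' h => by simp [ne_of_apply_ne w₂ h.ne]) (by simp)
      (fun β' h => by simp [ne_of_apply_ne w₃ h.ne])
    have hz : ∀ a, ∑ β', l β' * A β' a = 0 := fun a => by simpa using congrFun h0 a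
    simp only [hz, zero_mul, Finset.sum_const_zero] at h
    exact hx h.symm
  have hB₂ : ∀ β ∈ {b | ∃ x ∈ tensorSupport (actTensor A B C v), x.2.1 = b}, ∀ m : κ' → K, m β = 1 →
      (∀ β', w₂ β' < w₂ β → m β' = 0) → (fun b => ∑ β', m β' * B β' b) ≠ 0 := by
    rintro β ⟨x, hx, rfl⟩ m hm1 hmz h0
    have h := heval x hx (Pi.single x.1 1) m (Pi.single x.2.2 1) (by simp)
      (fun β' h => by simp [ne_of_apply_ne w₁ h.ne]) hm1 hmz (by simp)
      (fun β' h => by simp [ne_of_apply_ne w₃ h.ne])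
    have hz : ∀ b, ∑ β', m β' * B β' b = 0 := fun b => by simpa using congrFun h0 b
    simp only [hz, mul_zero, zero_mul, Finset.sum_const_zero] at h
    exact hx h.symm
  have hB₃ : ∀ β ∈ {c | ∃ x ∈ tensorSupport (actTensor A B C v), x.2.2 = c}, ∀ n : μ' → K, n β = 1 →
      (∀ β', w₃ β' < w₃ β → n β' = 0) → (fun c => ∑ β', n β' * C β' c) ≠ 0 := by
    rintro β ⟨x, hx, rfl⟩ n hn1 hnz h0
    have h := heval x hx (Pi.single x.1 1) (Pi.single x.2.1 1) n (by simp)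
      (fun β' h => by simp [ne_of_apply_ne w₁ h.ne]) (by simp)
      (fun β' h => by simp [ne_of_apply_ne w₂ h.ne]) hn1 hnz
    have hz : ∀ c, ∑ β', n β' * C β' c = 0 := fun c => by simpa using congrFun h0 c
    simp only [hz, mul_zero, zero_mul, Finset.sum_const_zero] at h
    exact hx h.symm
  obtain ⟨φ₁, hφ₁, h₁⟩ := exists_leading_injOn A r₁ hr₁ w₁ hw₁ _ hB₁
  obtain ⟨φ₂, hφ₂, h₂⟩ := exists_leading_injOn B r₂ hr₂ w₂ hw₂ _ hB₂
  obtain ⟨φ₃, hφ₃, h₃⟩ := exists_leading_injOn C r₃ hr₃ w₃ hw₃ _ hB₃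
  refine ⟨φ₁, φ₂, φ₃, hφ₁, hφ₂, hφ₃, fun x hx => ?_⟩
  obtain ⟨l, hl1, hlz, hlf⟩ := h₁ x.1
  obtain ⟨m, hm1, hmz, hmf⟩ := h₂ x.2.1
  obtain ⟨n, hn1, hnz, hnf⟩ := h₃ x.2.2
  have hval := heval x hx l m n hl1 hlz hm1 hmz hn1 hnz
  have hne : ∑ a, ∑ b, ∑ c, (∑ α, l α * A α a) * (∑ β, m β * B β b) * (∑ γ, n γ * C γ c) *
      v a b c ≠ 0 := by
    rw [hval]
    exact hx
  obtain ⟨a, -, ha⟩ := Finset.exists_ne_zero_of_sum_ne_zero hne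
  obtain ⟨b, -, hb⟩ := Finset.exists_ne_zero_of_sum_ne_zero ha
  obtain ⟨c, -, hc⟩ := Finset.exists_ne_zero_of_sum_ne_zero hb
  obtain ⟨habc, hv⟩ := mul_ne_zero_iff.1 hc
  obtain ⟨hab, hc'⟩ := mul_ne_zero_iff.1 habc
  obtain ⟨ha', hb'⟩ := mul_ne_zero_iff.1 hab
  refine ⟨(a, b, c), hv, ?_, ?_, ?_⟩
  · exact not_lt.1 fun h => ha' (hlf a h)
  · exact not_lt.1 fun h => hb' (hmf b h)
  · exact not_lt.1 fun h => hc' (hnf c h)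

end ThreeFactors

/-! ## Pushing a distribution forward along maps injective on the projections of its support -/

section Pushforward

variable {ι κ μ ι' κ' μ' : Type*}
variable [Fintype ι] [Fintype κ] [Fintype μ] [Fintype ι'] [Fintype κ'] [Fintype μ']
variable [DecidableEq ι] [DecidableEq κ] [DecidableEq μ]

/-- Regrouping `-∑ p log p` along a map injective on the support of `p`: the entropy of the image
distribution equals the entropy of `p` (each fibre carries at most one nonzero mass). [folklore] -/
theorem sum_negMulLog_fiberwise {X Y : Type*} [Fintype X] [Fintype Y] [DecidableEq Y] (g : X → Y)
    (p : X → ℝ) (hg : Set.InjOn g (Function.support p)) :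
    ∑ y, Real.negMulLog (∑ x ∈ Finset.univ.filter (fun x => g x = y), p x) =
      ∑ x, Real.negMulLog (p x) := by
  classical
  have h := Finset.sum_fiberwise_of_maps_to (s := Finset.univ) (t := Finset.univ) (g := g)
    (fun x _ => Finset.mem_univ (g x)) (fun x => Real.negMulLog (p x))
  rw [← h]
  refine Finset.sum_congr rfl fun y _ => ?_
  -- in the fibre of `y` at most one `x` has `p x ≠ 0`
  by_cases hex : ∃ x, g x = y ∧ p x ≠ 0
  · obtain ⟨x₀, hx₀, hp₀⟩ := hex
    have hmem : x₀ ∈ Finset.univ.filter (fun x => g x = y) := by simp [hx₀]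
    have huniq : ∀ x ∈ Finset.univ.filter (fun x => g x = y), x ≠ x₀ → p x = 0 := by
      intro x hx hne
      by_contra hpx
      exact hne (hg hpx hp₀ ((Finset.mem_filter.1 hx).2.trans hx₀.symm))
    rw [Finset.sum_eq_single x₀ (fun x hx hne => huniq x hx hne) (fun h' => absurd hmem h'),
      Finset.sum_eq_single x₀ (fun x hx hne => by rw [huniq x hx hne, Real.negMulLog_zero])
        (fun h' => absurd hmem h')]
  · push Not at hex
    have h0 : ∀ x ∈ Finset.univ.filter (fun x => g x = y), p x = 0 := fun x hx =>
      hex x (Finset.mem_filter.1 hx).2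
    rw [Finset.sum_eq_zero h0, Real.negMulLog_zero,
      Finset.sum_eq_zero (fun x hx => by rw [h0 x hx, Real.negMulLog_zero])]

omit [Fintype ι] in
/-- The first marginal of the pushforward along `φ₁ × φ₂ × φ₃` is the pushforward of the first marginal
along `φ₁`. [folklore] -/
theorem marginalDist₁_pushforward (P : ι' × κ' × μ' → ℝ) (φ₁ : ι' → ι) (φ₂ : κ' → κ) (φ₃ : μ' → μ)
    (a : ι) :
    marginalDist₁ (fun z : ι × κ × μ =>
      ∑ x ∈ Finset.univ.filter (fun x : ι' × κ' × μ' => (φ₁ x.1, φ₂ x.2.1, φ₃ x.2.2) = z), P x) a =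
      ∑ a' ∈ Finset.univ.filter (fun a' => φ₁ a' = a), marginalDist₁ P a' := by
  classical
  calc marginalDist₁ (fun z : ι × κ × μ => ∑ x ∈ Finset.univ.filter
          (fun x : ι' × κ' × μ' => (φ₁ x.1, φ₂ x.2.1, φ₃ x.2.2) = z), P x) a
      = ∑ b, ∑ c, ∑ x : ι' × κ' × μ',
          if (φ₁ x.1, φ₂ x.2.1, φ₃ x.2.2) = (a, b, c) then P x else 0 := by
        simp only [marginalDist₁, Finset.sum_filter]
    _ = ∑ b, ∑ x : ι' × κ' × μ', ∑ c,
          if (φ₁ x.1, φ₂ x.2.1, φ₃ x.2.2) = (a, b, c) then P x else 0 :=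
        Finset.sum_congr rfl fun b _ => Finset.sum_comm
    _ = ∑ x : ι' × κ' × μ', ∑ b, ∑ c,
          if (φ₁ x.1, φ₂ x.2.1, φ₃ x.2.2) = (a, b, c) then P x else 0 := Finset.sum_comm
    _ = ∑ x : ι' × κ' × μ', if φ₁ x.1 = a then P x else 0 := by
        refine Finset.sum_congr rfl fun x _ => ?_
        rw [Finset.sum_eq_single (φ₂ x.2.1)]
        · rw [Finset.sum_eq_single (φ₃ x.2.2)]
          · by_cases h : φ₁ x.1 = a <;> simp [h]
          · intro c _ hc
            rw [if_neg]
            simp only [Prod.mk.injEq, not_and]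
            intro _ _ h3
            exact hc h3.symm
          · simp
        · intro b _ hb
          refine Finset.sum_eq_zero fun c _ => ?_
          rw [if_neg]
          simp only [Prod.mk.injEq, not_and]
          intro _ h2
          exact absurd h2.symm hb
        · simp
    _ = ∑ a', ∑ b', ∑ c', if φ₁ a' = a then P (a', b', c') else 0 := by
        rw [Fintype.sum_prod_type]
        exact Finset.sum_congr rfl fun a' _ => by rw [Fintype.sum_prod_type]
    _ = ∑ a' ∈ Finset.univ.filter (fun a' => φ₁ a' = a), marginalDist₁ P a' := by
        rw [Finset.sum_filter]
        refine Finset.sum_congr rfl fun a' _ => ?_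
        by_cases h : φ₁ a' = a <;> simp [h, marginalDist₁]

omit [Fintype κ] in
/-- The second marginal of the pushforward is the pushforward of the second marginal. [folklore] -/
theorem marginalDist₂_pushforward (P : ι' × κ' × μ' → ℝ) (φ₁ : ι' → ι) (φ₂ : κ' → κ) (φ₃ : μ' → μ)
    (b : κ) :
    marginalDist₂ (fun z : ι × κ × μ =>
      ∑ x ∈ Finset.univ.filter (fun x : ι' × κ' × μ' => (φ₁ x.1, φ₂ x.2.1, φ₃ x.2.2) = z), P x) b =
      ∑ b' ∈ Finset.univ.filter (fun b' => φ₂ b' = b), marginalDist₂ P b' := by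
  classical
  calc marginalDist₂ (fun z : ι × κ × μ => ∑ x ∈ Finset.univ.filter
          (fun x : ι' × κ' × μ' => (φ₁ x.1, φ₂ x.2.1, φ₃ x.2.2) = z), P x) b
      = ∑ a, ∑ c, ∑ x : ι' × κ' × μ',
          if (φ₁ x.1, φ₂ x.2.1, φ₃ x.2.2) = (a, b, c) then P x else 0 := by
        simp only [marginalDist₂, Finset.sum_filter]
    _ = ∑ a, ∑ x : ι' × κ' × μ', ∑ c,
          if (φ₁ x.1, φ₂ x.2.1, φ₃ x.2.2) = (a, b, c) then P x else 0 :=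
        Finset.sum_congr rfl fun a _ => Finset.sum_comm
    _ = ∑ x : ι' × κ' × μ', ∑ a, ∑ c,
          if (φ₁ x.1, φ₂ x.2.1, φ₃ x.2.2) = (a, b, c) then P x else 0 := Finset.sum_comm
    _ = ∑ x : ι' × κ' × μ', if φ₂ x.2.1 = b then P x else 0 := by
        refine Finset.sum_congr rfl fun x _ => ?_
        rw [Finset.sum_eq_single (φ₁ x.1)]
        · rw [Finset.sum_eq_single (φ₃ x.2.2)]
          · by_cases h : φ₂ x.2.1 = b <;> simp [h]
          · intro c _ hc
            rw [if_neg]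
            simp only [Prod.mk.injEq, not_and]
            intro _ _ h3
            exact hc h3.symm
          · simp
        · intro a _ ha
          refine Finset.sum_eq_zero fun c _ => ?_
          rw [if_neg]
          simp only [Prod.mk.injEq, not_and]
          intro h1
          exact absurd h1.symm ha
        · simp
    _ = ∑ a', ∑ b', ∑ c', if φ₂ b' = b then P (a', b', c') else 0 := by
        rw [Fintype.sum_prod_type]
        exact Finset.sum_congr rfl fun a' _ => by rw [Fintype.sum_prod_type]
    _ = ∑ b', ∑ a', ∑ c', if φ₂ b' = b then P (a', b', c') else 0 := Finset.sum_comm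
    _ = ∑ b' ∈ Finset.univ.filter (fun b' => φ₂ b' = b), marginalDist₂ P b' := by
        rw [Finset.sum_filter]
        refine Finset.sum_congr rfl fun b' _ => ?_
        by_cases h : φ₂ b' = b <;> simp [h, marginalDist₂]

omit [Fintype μ] in
/-- The third marginal of the pushforward is the pushforward of the third marginal. [folklore] -/
theorem marginalDist₃_pushforward (P : ι' × κ' × μ' → ℝ) (φ₁ : ι' → ι) (φ₂ : κ' → κ) (φ₃ : μ' → μ)
    (c : μ) :
    marginalDist₃ (fun z : ι × κ × μ =>
      ∑ x ∈ Finset.univ.filter (fun x : ι' × κ' × μ' => (φ₁ x.1, φ₂ x.2.1, φ₃ x.2.2) = z), P x) c =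
      ∑ c' ∈ Finset.univ.filter (fun c' => φ₃ c' = c), marginalDist₃ P c' := by
  classical
  calc marginalDist₃ (fun z : ι × κ × μ => ∑ x ∈ Finset.univ.filter
          (fun x : ι' × κ' × μ' => (φ₁ x.1, φ₂ x.2.1, φ₃ x.2.2) = z), P x) c
      = ∑ a, ∑ b, ∑ x : ι' × κ' × μ',
          if (φ₁ x.1, φ₂ x.2.1, φ₃ x.2.2) = (a, b, c) then P x else 0 := by
        simp only [marginalDist₃, Finset.sum_filter]
    _ = ∑ a, ∑ x : ι' × κ' × μ', ∑ b,
          if (φ₁ x.1, φ₂ x.2.1, φ₃ x.2.2) = (a, b, c) then P x else 0 :=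
        Finset.sum_congr rfl fun a _ => Finset.sum_comm
    _ = ∑ x : ι' × κ' × μ', ∑ a, ∑ b,
          if (φ₁ x.1, φ₂ x.2.1, φ₃ x.2.2) = (a, b, c) then P x else 0 := Finset.sum_comm
    _ = ∑ x : ι' × κ' × μ', if φ₃ x.2.2 = c then P x else 0 := by
        refine Finset.sum_congr rfl fun x _ => ?_
        rw [Finset.sum_eq_single (φ₁ x.1)]
        · rw [Finset.sum_eq_single (φ₂ x.2.1)]
          · by_cases h : φ₃ x.2.2 = c <;> simp [h]
          · intro b _ hb
            rw [if_neg]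
            simp only [Prod.mk.injEq, not_and]
            intro _ h2
            exact absurd h2.symm hb
          · simp
        · intro a _ ha
          refine Finset.sum_eq_zero fun b _ => ?_
          rw [if_neg]
          simp only [Prod.mk.injEq, not_and]
          intro h1
          exact absurd h1.symm ha
        · simp
    _ = ∑ a', ∑ b', ∑ c', if φ₃ c' = c then P (a', b', c') else 0 := by
        rw [Fintype.sum_prod_type]
        exact Finset.sum_congr rfl fun a' _ => by rw [Fintype.sum_prod_type]
    _ = ∑ a', ∑ c', ∑ b', if φ₃ c' = c then P (a', b', c') else 0 :=
        Finset.sum_congr rfl fun a' _ => Finset.sum_comm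
    _ = ∑ c', ∑ a', ∑ b', if φ₃ c' = c then P (a', b', c') else 0 := Finset.sum_comm
    _ = ∑ c' ∈ Finset.univ.filter (fun c' => φ₃ c' = c), marginalDist₃ P c' := by
        rw [Finset.sum_filter]
        refine Finset.sum_congr rfl fun c' _ => ?_
        by_cases h : φ₃ c' = c <;> simp [h, marginalDist₃]

/-- Entropy of the first marginal is preserved by the pushforward when `φ₁` is injective on the first
projection of a set containing the support. [folklore] -/
theorem shannonEntropy_marginalDist₁_pushforward {P : ι' × κ' × μ' → ℝ} {S : Set (ι' × κ' × μ')}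
    (hs : Function.support P ⊆ S) (φ₁ : ι' → ι) (φ₂ : κ' → κ) (φ₃ : μ' → μ)
    (h₁ : Set.InjOn φ₁ {a | ∃ x ∈ S, x.1 = a}) :
    shannonEntropy (marginalDist₁ fun z : ι × κ × μ => ∑ x ∈ Finset.univ.filter
        (fun x : ι' × κ' × μ' => (φ₁ x.1, φ₂ x.2.1, φ₃ x.2.2) = z), P x) =
      shannonEntropy (marginalDist₁ P) := by
  classical
  simp only [shannonEntropy_def]
  congr 1
  rw [show (∑ a, Real.negMulLog (marginalDist₁ (fun z : ι × κ × μ => ∑ x ∈ Finset.univ.filter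
      (fun x : ι' × κ' × μ' => (φ₁ x.1, φ₂ x.2.1, φ₃ x.2.2) = z), P x) a)) =
      ∑ a, Real.negMulLog (∑ a' ∈ Finset.univ.filter (fun a' => φ₁ a' = a), marginalDist₁ P a') from
    Finset.sum_congr rfl fun a _ => by rw [marginalDist₁_pushforward]]
  refine sum_negMulLog_fiberwise φ₁ (marginalDist₁ P) fun a ha a' ha' h => h₁ ?_ ?_ h
  · obtain ⟨b, -, hb⟩ := Finset.exists_ne_zero_of_sum_ne_zero (Function.mem_support.1 ha)
    obtain ⟨c, -, hc⟩ := Finset.exists_ne_zero_of_sum_ne_zero hb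
    exact ⟨(a, b, c), hs (Function.mem_support.2 hc), rfl⟩
  · obtain ⟨b, -, hb⟩ := Finset.exists_ne_zero_of_sum_ne_zero (Function.mem_support.1 ha')
    obtain ⟨c, -, hc⟩ := Finset.exists_ne_zero_of_sum_ne_zero hb
    exact ⟨(a', b, c), hs (Function.mem_support.2 hc), rfl⟩

/-- Entropy of the second marginal is preserved by the pushforward. [folklore] -/
theorem shannonEntropy_marginalDist₂_pushforward {P : ι' × κ' × μ' → ℝ} {S : Set (ι' × κ' × μ')}
    (hs : Function.support P ⊆ S) (φ₁ : ι' → ι) (φ₂ : κ' → κ) (φ₃ : μ' → μ)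
    (h₂ : Set.InjOn φ₂ {b | ∃ x ∈ S, x.2.1 = b}) :
    shannonEntropy (marginalDist₂ fun z : ι × κ × μ => ∑ x ∈ Finset.univ.filter
        (fun x : ι' × κ' × μ' => (φ₁ x.1, φ₂ x.2.1, φ₃ x.2.2) = z), P x) =
      shannonEntropy (marginalDist₂ P) := by
  classical
  simp only [shannonEntropy_def]
  congr 1
  rw [show (∑ b, Real.negMulLog (marginalDist₂ (fun z : ι × κ × μ => ∑ x ∈ Finset.univ.filter
      (fun x : ι' × κ' × μ' => (φ₁ x.1, φ₂ x.2.1, φ₃ x.2.2) = z), P x) b)) =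
      ∑ b, Real.negMulLog (∑ b' ∈ Finset.univ.filter (fun b' => φ₂ b' = b), marginalDist₂ P b') from
    Finset.sum_congr rfl fun b _ => by rw [marginalDist₂_pushforward]]
  refine sum_negMulLog_fiberwise φ₂ (marginalDist₂ P) fun b hb b' hb' h => h₂ ?_ ?_ h
  · obtain ⟨a, -, ha⟩ := Finset.exists_ne_zero_of_sum_ne_zero (Function.mem_support.1 hb)
    obtain ⟨c, -, hc⟩ := Finset.exists_ne_zero_of_sum_ne_zero ha
    exact ⟨(a, b, c), hs (Function.mem_support.2 hc), rfl⟩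
  · obtain ⟨a, -, ha⟩ := Finset.exists_ne_zero_of_sum_ne_zero (Function.mem_support.1 hb')
    obtain ⟨c, -, hc⟩ := Finset.exists_ne_zero_of_sum_ne_zero ha
    exact ⟨(a, b', c), hs (Function.mem_support.2 hc), rfl⟩

/-- Entropy of the third marginal is preserved by the pushforward. [folklore] -/
theorem shannonEntropy_marginalDist₃_pushforward {P : ι' × κ' × μ' → ℝ} {S : Set (ι' × κ' × μ')}
    (hs : Function.support P ⊆ S) (φ₁ : ι' → ι) (φ₂ : κ' → κ) (φ₃ : μ' → μ)
    (h₃ : Set.InjOn φ₃ {c | ∃ x ∈ S, x.2.2 = c}) :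
    shannonEntropy (marginalDist₃ fun z : ι × κ × μ => ∑ x ∈ Finset.univ.filter
        (fun x : ι' × κ' × μ' => (φ₁ x.1, φ₂ x.2.1, φ₃ x.2.2) = z), P x) =
      shannonEntropy (marginalDist₃ P) := by
  classical
  simp only [shannonEntropy_def]
  congr 1
  rw [show (∑ c, Real.negMulLog (marginalDist₃ (fun z : ι × κ × μ => ∑ x ∈ Finset.univ.filter
      (fun x : ι' × κ' × μ' => (φ₁ x.1, φ₂ x.2.1, φ₃ x.2.2) = z), P x) c)) =
      ∑ c, Real.negMulLog (∑ c' ∈ Finset.univ.filter (fun c' => φ₃ c' = c), marginalDist₃ P c') from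
    Finset.sum_congr rfl fun c _ => by rw [marginalDist₃_pushforward]]
  refine sum_negMulLog_fiberwise φ₃ (marginalDist₃ P) fun c hc c' hc' h => h₃ ?_ ?_ h
  · obtain ⟨a, -, ha⟩ := Finset.exists_ne_zero_of_sum_ne_zero (Function.mem_support.1 hc)
    obtain ⟨b, -, hb⟩ := Finset.exists_ne_zero_of_sum_ne_zero ha
    exact ⟨(a, b, c), hs (Function.mem_support.2 hb), rfl⟩
  · obtain ⟨a, -, ha⟩ := Finset.exists_ne_zero_of_sum_ne_zero (Function.mem_support.1 hc')
    obtain ⟨b, -, hb⟩ := Finset.exists_ne_zero_of_sum_ne_zero ha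
    exact ⟨(a, b, c'), hs (Function.mem_support.2 hb), rfl⟩

/-- **Pushforward along maps injective on the projections of the support.** For a probability
distribution `P` on `ι' × κ' × μ'` supported in `S` and maps `φᵢ` injective on the three projections
of `S`, the pushforward `Q` of `P` along `φ₁ × φ₂ × φ₃` is a probability distribution with
`H_θ(Q) = H_θ(P)`, and every point charged by `Q` is the image of a point of `S`. [folklore] -/
theorem weightedEntropy_pushforward_eq (θ : Fin 3 → ℝ) {P : ι' × κ' × μ' → ℝ}
    (hP : P ∈ stdSimplex ℝ (ι' × κ' × μ')) {S : Set (ι' × κ' × μ')} (hs : Function.support P ⊆ S)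
    (φ₁ : ι' → ι) (φ₂ : κ' → κ) (φ₃ : μ' → μ) (h₁ : Set.InjOn φ₁ {a | ∃ x ∈ S, x.1 = a})
    (h₂ : Set.InjOn φ₂ {b | ∃ x ∈ S, x.2.1 = b}) (h₃ : Set.InjOn φ₃ {c | ∃ x ∈ S, x.2.2 = c}) :
    (fun z : ι × κ × μ => ∑ x ∈ Finset.univ.filter
        (fun x : ι' × κ' × μ' => (φ₁ x.1, φ₂ x.2.1, φ₃ x.2.2) = z), P x) ∈ stdSimplex ℝ (ι × κ × μ) ∧
    weightedEntropy θ (fun z : ι × κ × μ => ∑ x ∈ Finset.univ.filter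
        (fun x : ι' × κ' × μ' => (φ₁ x.1, φ₂ x.2.1, φ₃ x.2.2) = z), P x) = weightedEntropy θ P ∧
    ∀ z : ι × κ × μ, (∑ x ∈ Finset.univ.filter
        (fun x : ι' × κ' × μ' => (φ₁ x.1, φ₂ x.2.1, φ₃ x.2.2) = z), P x) ≠ 0 →
      ∃ x ∈ S, (φ₁ x.1, φ₂ x.2.1, φ₃ x.2.2) = z := by
  classical
  refine ⟨⟨fun z => Finset.sum_nonneg fun x _ => hP.1 x, ?_⟩, ?_, ?_⟩
  · have h := Finset.sum_fiberwise_of_maps_to (s := Finset.univ) (t := Finset.univ)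
      (g := fun x : ι' × κ' × μ' => (φ₁ x.1, φ₂ x.2.1, φ₃ x.2.2)) (fun x _ => Finset.mem_univ _) P
    rw [h]
    exact hP.2
  · simp only [weightedEntropy, shannonEntropy_marginalDist₁_pushforward hs φ₁ φ₂ φ₃ h₁,
      shannonEntropy_marginalDist₂_pushforward hs φ₁ φ₂ φ₃ h₂,
      shannonEntropy_marginalDist₃_pushforward hs φ₁ φ₂ φ₃ h₃]
  · intro z hz
    obtain ⟨x, hx, hPx⟩ := Finset.exists_ne_zero_of_sum_ne_zero hz
    exact ⟨x, hs (Function.mem_support.2 hPx), (Finset.mem_filter.1 hx).2⟩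

end Pushforward

/-! ## The main theorem -/

section Main

variable {K : Type*} [Field K] {ι κ μ ι' κ' μ' : Type*}
variable [Fintype ι] [Fintype κ] [Fintype μ] [Fintype ι'] [Fintype κ'] [Fintype μ']

variable [DecidableEq ι] [DecidableEq κ] [DecidableEq μ] [DecidableEq ι'] [DecidableEq κ'] [DecidableEq μ']

/-- **Strassen's lower bound along restrictions to oblique tensors.** Let `v ≥ u` (restriction) and
suppose the support of `u` in the standard bases is an antichain for the product of the total orders
given by injective weights `w₁, w₂, w₃` (so `u` is oblique, CVZ Def. 2.18). Then for every `θ ≥ 0`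
and every probability distribution `P` supported in `supp u`,
`H_θ(P) ≤ ρ^θ(v) = log₂ ζ^θ(v)`: in every basis `g` of `v`, `u` is still a restriction of `g·v`;
order the new index sets by the ordering lemma, map `supp u` into the upper closure of `supp (g·v)`
by CVZ Prop. 2.16 and push `P` forward. (This is `ζ^θ(v) ≥ ζ^θ(u) ≥ ζ_θ(u) ≥ 2^{H_θ(P)}`,
[CVZ23, Thm. 2.4(4), Thm. 2.15, Thm. 2.19], in one step.)
[cite: ChristandlVranaZuiddam2023, Thm. 2.19] -/
theorem weightedEntropy_le_logUpperSupportFunctional_of_restrictsTo {W₁ W₂ W₃ : Type*}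
    [LinearOrder W₁] [LinearOrder W₂] [LinearOrder W₃]
    (v : ι → κ → μ → K) (u : ι' → κ' → μ' → K) (hvu : TensorRestrictsTo v u)
    (w₁ : ι' → W₁) (w₂ : κ' → W₂) (w₃ : μ' → W₃)
    (hw₁ : Function.Injective w₁) (hw₂ : Function.Injective w₂) (hw₃ : Function.Injective w₃)
    (hanti : ∀ x ∈ tensorSupport u, ∀ y ∈ tensorSupport u,
      w₁ x.1 ≤ w₁ y.1 → w₂ x.2.1 ≤ w₂ y.2.1 → w₃ x.2.2 ≤ w₃ y.2.2 → y = x)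
    {θ : Fin 3 → ℝ} (hθ : ∀ i, 0 ≤ θ i) {P : ι' × κ' × μ' → ℝ}
    (hP : P ∈ stdSimplex ℝ (ι' × κ' × μ')) (hPs : Function.support P ⊆ tensorSupport u) :
    weightedEntropy θ P ≤ logUpperSupportFunctional θ v := by
  classical
  obtain ⟨A, B, C, rfl⟩ := (tensorRestrictsTo_iff_exists_actTensor v u).1 hvu
  -- some point is charged by `P`, so all index types of `v` are nonempty
  obtain ⟨x₀, hx₀⟩ : ∃ x, P x ≠ 0 := by
    by_contra h
    push Not at h
    have := hP.2
    simp [h] at this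
  have hu₀ : actTensor A B C v x₀.1 x₀.2.1 x₀.2.2 ≠ 0 := hPs (Function.mem_support.2 hx₀)
  haveI : Nonempty ι := by
    by_contra h
    rw [not_nonempty_iff] at h
    exact hu₀ (by simp [actTensor_apply])
  haveI : Nonempty κ := by
    by_contra h
    rw [not_nonempty_iff] at h
    exact hu₀ (by simp [actTensor_apply])
  haveI : Nonempty μ := by
    by_contra h
    rw [not_nonempty_iff] at h
    exact hu₀ (by simp [actTensor_apply])
  unfold logUpperSupportFunctional
  refine le_ciInf fun g => ?_
  -- `u` as a restriction of `g·v`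
  set v' := actTensor (g.1 : Matrix ι ι K) (g.2.1 : Matrix κ κ K) (g.2.2 : Matrix μ μ K) v with hv'
  have hA : IsUnit (g.1 : Matrix ι ι K).det := (Matrix.isUnit_iff_isUnit_det _).1 (Units.isUnit g.1)
  have hB : IsUnit (g.2.1 : Matrix κ κ K).det :=
    (Matrix.isUnit_iff_isUnit_det _).1 (Units.isUnit g.2.1)
  have hC : IsUnit (g.2.2 : Matrix μ μ K).det :=
    (Matrix.isUnit_iff_isUnit_det _).1 (Units.isUnit g.2.2)
  have hu : actTensor A B C v = actTensor (A * (g.1 : Matrix ι ι K)⁻¹) (B * (g.2.1 : Matrix κ κ K)⁻¹)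
      (C * (g.2.2 : Matrix μ μ K)⁻¹) v' := by
    rw [hv', actTensor_actTensor, Matrix.mul_assoc, Matrix.mul_assoc, Matrix.mul_assoc,
      Matrix.nonsing_inv_mul _ hA, Matrix.nonsing_inv_mul _ hB, Matrix.nonsing_inv_mul _ hC,
      Matrix.mul_one, Matrix.mul_one, Matrix.mul_one]
  obtain ⟨r₁, r₂, r₃, hr₁, hr₂, hr₃, hord⟩ := exists_ranks_upperClosure hθ (tensorSupport v')
  rw [hu] at hanti hPs
  obtain ⟨φ₁, φ₂, φ₃, hφ₁, hφ₂, hφ₃, hle⟩ := exists_support_le_of_actTensor v' _ _ _ w₁ w₂ w₃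
    hw₁ hw₂ hw₃ hanti r₁ r₂ r₃ hr₁ hr₂ hr₃
  obtain ⟨hQ, hHQ, hQs⟩ := weightedEntropy_pushforward_eq θ hP hPs φ₁ φ₂ φ₃ hφ₁ hφ₂ hφ₃
  rw [← hHQ]
  refine hord _ hQ fun z hz => ?_
  obtain ⟨x, hx, rfl⟩ := hQs z hz
  obtain ⟨y, hy, h1, h2, h3⟩ := hle x hx
  exact ⟨y, hy, h1, h2, h3⟩

/-- Exponentiated form: under the hypotheses of
`weightedEntropy_le_logUpperSupportFunctional_of_restrictsTo`, `2^{H_θ(P)} ≤ ζ^θ(v)`.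
[cite: ChristandlVranaZuiddam2023, Thm. 2.19] -/
theorem rpow_weightedEntropy_le_upperSupportFunctional_of_restrictsTo {W₁ W₂ W₃ : Type*}
    [LinearOrder W₁] [LinearOrder W₂] [LinearOrder W₃]
    (v : ι → κ → μ → K) (u : ι' → κ' → μ' → K) (hvu : TensorRestrictsTo v u)
    (w₁ : ι' → W₁) (w₂ : κ' → W₂) (w₃ : μ' → W₃)
    (hw₁ : Function.Injective w₁) (hw₂ : Function.Injective w₂) (hw₃ : Function.Injective w₃)
    (hanti : ∀ x ∈ tensorSupport u, ∀ y ∈ tensorSupport u,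
      w₁ x.1 ≤ w₁ y.1 → w₂ x.2.1 ≤ w₂ y.2.1 → w₃ x.2.2 ≤ w₃ y.2.2 → y = x)
    {θ : Fin 3 → ℝ} (hθ : ∀ i, 0 ≤ θ i) {P : ι' × κ' × μ' → ℝ}
    (hP : P ∈ stdSimplex ℝ (ι' × κ' × μ')) (hPs : Function.support P ⊆ tensorSupport u) :
    (2 : ℝ) ^ weightedEntropy θ P ≤ upperSupportFunctional θ v := by
  have hv : v ≠ 0 := by
    rintro rfl
    obtain ⟨x₀, hx₀⟩ : ∃ x, P x ≠ 0 := by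
      by_contra h
      push Not at h
      have := hP.2
      simp [h] at this
    have hu₀ := hPs (Function.mem_support.2 hx₀)
    obtain ⟨A, B, C, rfl⟩ := (tensorRestrictsTo_iff_exists_actTensor _ u).1 hvu
    simp at hu₀
  rw [upperSupportFunctional, if_neg hv]
  exact Real.rpow_le_rpow_of_exponent_le one_le_two
    (weightedEntropy_le_logUpperSupportFunctional_of_restrictsTo v u hvu w₁ w₂ w₃ hw₁ hw₂ hw₃ hanti
      hθ hP hPs)

end Main

end Literature.Computability.AlgebraicComplexity

end
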